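import Mathlib
import Summits.Ventures.HodgeRepro0.P1FermatCertDefsExt

/-!
# p1 — the ℚ(ζ₂₁) sixfold of Weil type relative to ℚ(√−7) closes with two cancelling pairs

m = 42, Φ = Φ_{1,14} = [1,5,11,13,19,25] ⊂ (ℤ/42)^× (E = ℚ(ζ₂₁), g = 6, rank(𝓗/Π) = 1; P1LatticeCertsS9b): the two members
Q, −Q of the exceptional orbit (the ℚ(√−7)-Weil family) decompose after adjoining the pairs (21,21), (21,21):
`IsShiodaCertExt 42 Φ S [1,14,27] [21,21] blocks` (P1FermatCertDefsExt; p6 Criterion 5.7.1 in its iterated form, Aoki 1987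
Thm 1-4(ii) twice). With the lattice certificate this gives, at print level, HC(A) and HC(Aⁿ) for all n for this sixfold —
the last of the seven dimension-6 degenerate Fermat rows (proofs/p1-lattice-calculus.md §4d) — and an instance of algebraic
Weil classes on a simple CM sixfold of Weil type. Found by work/job_ext3 (two-pair refinement), verified independently.
-/

namespace HodgeRepro0.P1.FermatCert

/-- m = 42, Φ_{1,14}, the family Q = {1,11,23,25,29,37} (= the index-2 subgroup {t ≡ 1,2,4 mod 7}) -/
theorem zeta42_weil_family_Q :
    IsShiodaCertExt 42 [1, 5, 11, 13, 19, 25] [1, 11, 23, 25, 29, 37] [1, 14, 27] [21, 21]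
      [[1, 21, 25, 37], [3, 21, 27, 33], [3, 21, 27, 33], [11, 21, 23, 29], [14, 28], [14, 28], [14, 28]] := by decide

/-- m = 42, Φ_{1,14}, the family −Q = {5,13,17,19,31,41} -/
theorem zeta42_weil_family_negQ :
    IsShiodaCertExt 42 [1, 5, 11, 13, 19, 25] [5, 13, 17, 19, 31, 41] [1, 14, 27] [21, 21]
      [[5, 17, 21, 41], [9, 15, 21, 39], [9, 15, 21, 39], [13, 19, 21, 31], [14, 28], [14, 28], [14, 28]] := by decide

end HodgeRepro0.P1.FermatCert
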